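import Summits.CriticalPhenomena.PercolationContinuityZ3.Theorems.PercNearOneGluingNoHeavyLowerTailOneCutFiveAssembly
import HarnessLib

/-!
# `NoHeavyLowerTail` (stmt-CriticalPhenomena-4575) — the glued half of the `|A| = 5` one-cut bound follows from a
# FOUR-POINT "zero-or-one" row `Z(3,2)`

Support file (prover seat `prim-a5-assembly-1`, `--supports stmt-CriticalPhenomena-4575`; memo
`run/shared/lean/prim/prim-a5/ASSEMBLY.md` §9).  One `Prop` definition (an open row, tagged `@[conjecture]`), no sorries,
standard axioms.

`Z(3,2)` (`OneCutFive.ZeroOneThree`): for an observer `o` and THREE vertices `R = {a,b,c}` of any finite weighted graph with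
`μ(o ↔ a) + μ(o ↔ b) + μ(o ↔ c) > 2`:  `μ{o reaches at most one of a,b,c} ≤ max_{v∈R} μ(o ↮ v)`, equivalently
`μ{o reaches ≥ 2 of R} ≥ min_{v∈R} μ(o ↔ v)`, equivalently `μ(B = {v_min}) ≤ μ(B = R ∖ v_min)` for the pocket `B ⊆ R` of `o`.
Census (this seat, exact 15-cell laws): 0 violations on 1 745 random weighted `K₅,K₆,K₇` and under adversarial climbs (equality
on ties / glued configurations); FALSE at threshold `Σ = 1` (two relays); NOT implied by Harris-type rows on 56 connection events +
the 12 tripod exchanges + SHK3⁺ on the four triples (explicit 15-cell pseudo-law, ASSEMBLY.md §9) — a proof needs disjoint-occurrence /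
two-cluster structure.  OPEN.

RESULTS.  `twoFinger_at_observer_of_zeroOneThree`: `Z(3,2)` implies the two-finger bound at a relay observer — for `A.card = 5`,
`o ∈ A`, `E N > 4` and `t` bounding the cuts `μ(o ↮ b)`, `b ∈ A ∖ o`: `μ{|T_o| ≤ 2} ≤ t` (drop ANY one further relay `a₁`; the remaining
three have `Σ μ(o ↔ ·) ≥ E N − 2 > 2`, and `|T_o| ≤ 2` forces at most one of them to be reached); hence
`oneCut5_at_of_mem_of_zeroOneThree`: the `o ∈ A` half of `OneCutFive.OneCut5`.  By the same bookkeeping `Z(3,2)` gives, for every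
`m ≥ 3`, `Σ_{i≤m} μ(o ↔ a_i) > m − 1 ⇒ μ{o reaches ≥ 2 of the a_i} ≥ min_i μ(o ↔ a_i)` (not formalised here).
[cite: KozmaNitzan2024, Lemma 2 (p. 6) (level 1 of this family; the level-2 row is ours)]
-/

noncomputable section

namespace Summit.CriticalPhenomena.PercolationContinuityZ3.Theorems

open MeasureTheory Set Literature.Probability.LatticeModels Literature.Probability.Percolation
open scoped Classical BigOperators

namespace OneCutFive

variable {n : ℕ}

/-- **`Z(3,2)` (zero-or-one row for three relays).**  For every finite weighted graph, observer `o`, three-element vertex set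
`R` with `Σ_{v∈R} μ(o ↔ v) > 2`, and `t` bounding the three cuts `μ(o ↮ v)`: `μ{o reaches at most one vertex of R} ≤ t`.
OPEN (conjectured in this programme; census-validated on `K₅–K₇`; false with two relays and threshold `1`).
[cite: KozmaNitzan2024, Lemma 2 (p. 6) (level 1; the level-2 row is ours)] [status: open] -/
@[conjecture] def ZeroOneThree : Prop :=
  ∀ (n : ℕ) (w : Sym2 (Fin n) → unitInterval) (R : Finset (Fin n)) (o : Fin n) (t : ℝ), R.card = 3 →
    2 < ∑ v ∈ R, (prodBernoulli w).real (openConn o v) →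
    (∀ v ∈ R, (prodBernoulli w).real (openConn o v)ᶜ ≤ t) →
    (prodBernoulli w).real {ω : BondConfig (Fin n) | (R.filter fun v => ω ∈ openConn o v).card ≤ 1} ≤ t

/-- If `o ∈ A`, `o ∉ R ⊆ A`, then `|T_o| ≤ 2` forces `o` to reach at most one vertex of `R`
(`T_o ⊇ {o} ∪ (R ∩ T_o)`). [this work] -/
theorem card_filter_le_one_of_le_two (A R : Finset (Fin n)) (o : Fin n) (ho : o ∈ A) (hR : R ⊆ A) (hoR : o ∉ R)
    (ω : BondConfig (Fin n)) (h : (A.filter fun x => ω ∈ openConn o x).card ≤ 2) :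
    (R.filter fun v => ω ∈ openConn o v).card ≤ 1 := by
  have hsub : insert o (R.filter fun v => ω ∈ openConn o v) ⊆ A.filter fun x => ω ∈ openConn o x := by
    intro x hx
    rcases Finset.mem_insert.1 hx with rfl | hx
    · exact Finset.mem_filter.2 ⟨ho, (SimpleGraph.Reachable.refl x : (openGraph ω).Reachable x x)⟩
    · exact Finset.mem_filter.2 ⟨hR (Finset.mem_filter.1 hx).1, (Finset.mem_filter.1 hx).2⟩
  have hnot : o ∉ R.filter fun v => ω ∈ openConn o v := fun h' => hoR (Finset.mem_filter.1 h').1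
  have hcard := Finset.card_le_card hsub
  rw [Finset.card_insert_of_notMem hnot] at hcard
  omega

/-- **`Z(3,2)` ⇒ the two-finger bound at a relay observer.**  For `A.card = 5`, `o ∈ A`, `E N > 4` and `t` bounding
`μ(o ↮ b)` for `b ∈ A ∖ o`: `μ{|T_o| ≤ 2} ≤ t`. [this work] -/
theorem twoFinger_at_observer_of_zeroOneThree (hZ : ZeroOneThree) (w : Sym2 (Fin n) → unitInterval)
    (A : Finset (Fin n)) (o : Fin n) (t : ℝ) (hA : A.card = 5) (ho : o ∈ A)
    (hEN : 4 < ∑ x ∈ A, (prodBernoulli w).real (openConn o x))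
    (hcut : ∀ b ∈ A, b ≠ o → (prodBernoulli w).real (openConn o b)ᶜ ≤ t) :
    (prodBernoulli w).real {ω : BondConfig (Fin n) | (A.filter fun x => ω ∈ openConn o x).card ≤ 2} ≤ t := by
  -- drop `o` and one further relay `a₁`
  have hAo : (A.erase o).card = 4 := by rw [Finset.card_erase_of_mem ho, hA]
  obtain ⟨a₁, ha₁⟩ : (A.erase o).Nonempty := Finset.card_pos.1 (by omega)
  set R := (A.erase o).erase a₁ with hRdef
  have hRcard : R.card = 3 := by rw [hRdef, Finset.card_erase_of_mem ha₁, hAo]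
  have hRsubAo : R ⊆ A.erase o := Finset.erase_subset _ _
  have hRsub : R ⊆ A := hRsubAo.trans (Finset.erase_subset _ _)
  have hoR : o ∉ R := fun h => (Finset.mem_erase.1 (hRsubAo h)).1 rfl
  -- the three remaining relays have `Σ μ(o ↔ ·) > 2`
  have hsumA : (prodBernoulli w).real (openConn o o) + ∑ x ∈ A.erase o, (prodBernoulli w).real (openConn o x) =
      ∑ x ∈ A, (prodBernoulli w).real (openConn o x) :=
    Finset.add_sum_erase A (fun x => (prodBernoulli w).real (openConn o x)) ho
  have hsumAo : (prodBernoulli w).real (openConn o a₁) + ∑ x ∈ R, (prodBernoulli w).real (openConn o x) =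
      ∑ x ∈ A.erase o, (prodBernoulli w).real (openConn o x) :=
    Finset.add_sum_erase (A.erase o) (fun x => (prodBernoulli w).real (openConn o x)) ha₁
  have h1 : (prodBernoulli w).real (openConn o o) ≤ 1 := measureReal_le_one
  have h2 : (prodBernoulli w).real (openConn o a₁) ≤ 1 := measureReal_le_one
  have hsumR : 2 < ∑ x ∈ R, (prodBernoulli w).real (openConn o x) := by linarith
  -- event inclusion and `Z(3,2)`
  have hsub : {ω : BondConfig (Fin n) | (A.filter fun x => ω ∈ openConn o x).card ≤ 2} ⊆
      {ω : BondConfig (Fin n) | (R.filter fun v => ω ∈ openConn o v).card ≤ 1} :=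
    fun ω hω => card_filter_le_one_of_le_two A R o ho hRsub hoR ω hω
  refine (measureReal_mono hsub).trans (hZ n w R o t hRcard hsumR fun v hv => ?_)
  exact hcut v (hRsub hv) (fun hvo => hoR (hvo ▸ hv))

/-- **The glued half of oneCut(5) from `Z(3,2)`.**  If `o ∈ A`, `A.card = 5` and all relay–relay cuts are `≤ t`, then the
minority event has mass `≤ t` (case `E N ≤ 4` by the lonely-relay lemma, case `E N > 4` by `Z(3,2)`). [this work] -/
theorem oneCut5_at_of_mem_of_zeroOneThree (hZ : ZeroOneThree) (w : Sym2 (Fin n) → unitInterval) (A : Finset (Fin n))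
    (o : Fin n) (t : ℝ) (hA : A.card = 5) (ho : o ∈ A) (ht : 0 ≤ t)
    (hcut : ∀ a ∈ A, ∀ a' ∈ A, a ≠ a' → (prodBernoulli w).real (openConn a a')ᶜ ≤ t) :
    (prodBernoulli w).real {ω : BondConfig (Fin n) |
        1 ≤ (A.filter fun a => ω ∈ openConn o a).card ∧
        ((A.filter fun a => ω ∈ openConn o a).card : ℝ) <
          (∑ a ∈ A, (prodBernoulli w).real (openConn o a)) / 2} ≤ t := by
  by_cases hEN : (∑ x ∈ A, (prodBernoulli w).real (openConn o x)) ≤ 4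
  · exact oneCut_of_sum_le_four n w A o t hEN ht hcut
  · have hEN' : 4 < ∑ x ∈ A, (prodBernoulli w).real (openConn o x) := lt_of_not_ge hEN
    have hsub : {ω : BondConfig (Fin n) | 1 ≤ (A.filter fun a => ω ∈ openConn o a).card ∧
          ((A.filter fun a => ω ∈ openConn o a).card : ℝ) < (∑ a ∈ A, (prodBernoulli w).real (openConn o a)) / 2} ⊆
        {ω : BondConfig (Fin n) | (A.filter fun x => ω ∈ openConn o x).card ≤ 2} :=
      fun ω hω => (minority_subset_le_two w A o hA hω).2
    exact (measureReal_mono hsub).trans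
      (twoFinger_at_observer_of_zeroOneThree hZ w A o t hA ho hEN' fun b hb hbo => hcut o ho b hb hbo.symm)

end OneCutFive

end Summit.CriticalPhenomena.PercolationContinuityZ3.Theorems
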